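import Mathlib
import Summits.NavierStokesRegularity.NavierStokesRegularity.Theorems.FilamentSkeletonRssSkeletonJ1RLiaGeometry
import Summits.NavierStokesRegularity.NavierStokesRegularity.Theorems.FilamentSkeletonRssSkeletonJ1RLiaShooting
import Literature.Analysis.FluidPDE.LeiZhang2011Proofs

/-!
# Crux `SkeletonJ1R` (stmt-NavierStokesRegularity-23610) · line `streamline_kantorovich_R` · toward stub F2-d (`LiaDefectDerivBL`, v7), brick of S4′ for B1′:
# POINTWISE BOUND FOR THE SECOND DERIVATIVE OF A LORENTZIAN DATUM-LINE STRAND ALONG A PATH — `‖S″‖ ≤ 28/d³ + 6κ/d²`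

Hand `leafhand-ns-filamentskeletonrs-1` (gen 0), `--supports stmt-NavierStokesRegularity-23610 --as helper`.  MODEL rung, NEGATIVE side of the ladder:
calculus for a HYPOTHETICAL filament-type blow-up skeleton; nothing here is a claim about Navier–Stokes regularity; the stub and the crux stay OPEN.

The Lipschitz constant `H′` of `x‴` on the window (input of `…LiaSelfDerivEstimate.symmDerivStrand_sub_lia_le`) needs the SECOND derivative along the reference of
the partners' closed-form Lorentzian strands `S(p) = (2/q)•t×(y(p) − w)`, `q = ‖y−w‖² − ⟪y−w,t⟫² + a` (`…LiaReference.ambientField_eq`,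
first derivative `…LiaDefectDerivStrands.hasDerivAt_lorentzStrand_comp`: `S′ = (−2q′/q²)•t×(y−w) + (2/q)•t×y′`).  Along the path `q` is a SCALAR function, so no
abstract `D²W` is needed: with `q′ = 2⟪v,y′⟫ − 2⟪v,t⟫⟪y′,t⟫`, `q″ = 2⟪y′,y′⟫ + 2⟪v,y″⟫ − 2⟪y′,t⟫² − 2⟪v,t⟫⟪y″,t⟫` (`v = y − w`),
`S″ = (−2q″/q² + 4q′²/q³)•t×v − (4q′/q²)•t×y′ + (2/q)•t×y″`.  This file proves the pointwise algebra:
* `abs_lorentzQ_deriv_le` : `|q′| ≤ 2√q‖y′‖` (only the perpendicular component of `v` enters: `q′ = 2⟪v⊥, y′⟫`, `‖v⊥‖² = q − a ≤ q`);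
* `abs_lorentzQ_deriv_two_le` : `|q″| ≤ 2‖y′‖² + 2√q‖y″‖`;
* `norm_cross_le_sqrt_lorentzQ` : `‖t×v‖ ≤ √q`;
* `norm_lorentzStrand_deriv_two_le` : for `‖y′‖ ≤ 1`, `‖y″‖ ≤ κ`, `d² ≤ q` (`d > 0`): `‖S″‖ ≤ 28/d³ + 6κ/d²`.
The `HasDerivAt` statement `(S′)′ = S″` along a `C²` path (product/quotient rules, as in `hasDerivAt_lorentzStrand_comp`) is left to the S4′ file.
-/

set_option linter.dupNamespace false -- `NavierStokesRegularity.NavierStokesRegularity` path/namespace repetition is the tree convention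

noncomputable section

namespace Summit.NavierStokesRegularity.NavierStokesRegularity.Theorems.SkeletonJ1RFrame

open Set Function Filter MeasureTheory Real Topology
open Literature.Analysis.FluidPDE
open scoped InnerProductSpace BigOperators

/-- The perpendicular part controls `q`: `‖v − ⟪v,t⟫t‖ ≤ √(‖v‖² − ⟪v,t⟫² + a)` for `‖t‖ = 1`, `a ≥ 0`. [folklore] -/
theorem norm_perpTo_le_sqrt_lorentzQ {a : ℝ} (ha : 0 ≤ a) (t v : EuclideanSpace ℝ (Fin 3)) (ht : ‖t‖ = 1) :
    ‖v - (inner ℝ v t) • t‖ ≤ Real.sqrt (‖v‖ ^ 2 - (inner ℝ v t) ^ 2 + a) := by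
  refine Real.le_sqrt_of_sq_le ?_
  rw [norm_perpTo_sq t v ht]; linarith

/-- `‖t × v‖ ≤ √q`. [folklore] -/
theorem norm_cross_le_sqrt_lorentzQ {a : ℝ} (ha : 0 ≤ a) (t v : EuclideanSpace ℝ (Fin 3)) (ht : ‖t‖ = 1) :
    ‖cross t v‖ ≤ Real.sqrt (‖v‖ ^ 2 - (inner ℝ v t) ^ 2 + a) := by
  refine Real.le_sqrt_of_sq_le ?_
  rw [norm_cross_sq_of_unit t v ht]; linarith

/-- **`|q′| ≤ 2√q·‖y′‖`**: `q′ = 2⟪v,y′⟫ − 2⟪v,t⟫⟪y′,t⟫ = 2⟪v⊥, y′⟫`. [folklore] -/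
theorem abs_lorentzQ_deriv_le {a : ℝ} (ha : 0 ≤ a) (t v y' : EuclideanSpace ℝ (Fin 3)) (ht : ‖t‖ = 1) :
    |2 * ⟪v, y'⟫_ℝ - 2 * ⟪v, t⟫_ℝ * ⟪y', t⟫_ℝ| ≤ 2 * Real.sqrt (‖v‖ ^ 2 - (inner ℝ v t) ^ 2 + a) * ‖y'‖ := by
  have hperp : ⟪v - (inner ℝ v t) • t, y'⟫_ℝ = ⟪v, y'⟫_ℝ - ⟪v, t⟫_ℝ * ⟪y', t⟫_ℝ := by
    rw [inner_sub_left, inner_smul_left, real_inner_comm t y']; simp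
  have h : 2 * ⟪v, y'⟫_ℝ - 2 * ⟪v, t⟫_ℝ * ⟪y', t⟫_ℝ = 2 * ⟪v - (inner ℝ v t) • t, y'⟫_ℝ := by rw [hperp]; ring
  rw [h, abs_mul, abs_two, mul_assoc]
  refine mul_le_mul_of_nonneg_left ?_ (by norm_num)
  exact (abs_real_inner_le_norm _ _).trans (mul_le_mul_of_nonneg_right (norm_perpTo_le_sqrt_lorentzQ ha t v ht) (norm_nonneg _))

/-- **`|q″| ≤ 2‖y′‖² + 2√q·‖y″‖`**: `q″ = 2(‖y′‖² − ⟪y′,t⟫²) + 2⟪v⊥, y″⟫`. [folklore] -/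
theorem abs_lorentzQ_deriv_two_le {a : ℝ} (ha : 0 ≤ a) (t v y' y'' : EuclideanSpace ℝ (Fin 3)) (ht : ‖t‖ = 1) :
    |2 * ⟪y', y'⟫_ℝ + 2 * ⟪v, y''⟫_ℝ - 2 * ⟪y', t⟫_ℝ ^ 2 - 2 * ⟪v, t⟫_ℝ * ⟪y'', t⟫_ℝ| ≤
      2 * ‖y'‖ ^ 2 + 2 * Real.sqrt (‖v‖ ^ 2 - (inner ℝ v t) ^ 2 + a) * ‖y''‖ := by
  have hperp : ⟪v - (inner ℝ v t) • t, y''⟫_ℝ = ⟪v, y''⟫_ℝ - ⟪v, t⟫_ℝ * ⟪y'', t⟫_ℝ := by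
    rw [inner_sub_left, inner_smul_left, real_inner_comm t y'']; simp
  have hsq : ⟪y', y'⟫_ℝ = ‖y'‖ ^ 2 := real_inner_self_eq_norm_sq y'
  have h : 2 * ⟪y', y'⟫_ℝ + 2 * ⟪v, y''⟫_ℝ - 2 * ⟪y', t⟫_ℝ ^ 2 - 2 * ⟪v, t⟫_ℝ * ⟪y'', t⟫_ℝ =
      2 * (‖y'‖ ^ 2 - ⟪y', t⟫_ℝ ^ 2) + 2 * ⟪v - (inner ℝ v t) • t, y''⟫_ℝ := by rw [hperp, hsq]; ring
  rw [h]
  have h1 : 0 ≤ ‖y'‖ ^ 2 - ⟪y', t⟫_ℝ ^ 2 := by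
    have := abs_real_inner_le_norm y' t
    rw [ht, mul_one] at this
    nlinarith [abs_nonneg ⟪y', t⟫_ℝ, sq_abs ⟪y', t⟫_ℝ]
  have h1' : ‖y'‖ ^ 2 - ⟪y', t⟫_ℝ ^ 2 ≤ ‖y'‖ ^ 2 := by nlinarith [sq_nonneg ⟪y', t⟫_ℝ]
  have h2 : |⟪v - (inner ℝ v t) • t, y''⟫_ℝ| ≤ Real.sqrt (‖v‖ ^ 2 - (inner ℝ v t) ^ 2 + a) * ‖y''‖ :=
    (abs_real_inner_le_norm _ _).trans (mul_le_mul_of_nonneg_right (norm_perpTo_le_sqrt_lorentzQ ha t v ht) (norm_nonneg _))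
  calc _ ≤ |2 * (‖y'‖ ^ 2 - ⟪y', t⟫_ℝ ^ 2)| + |2 * ⟪v - (inner ℝ v t) • t, y''⟫_ℝ| := abs_add_le _ _
    _ ≤ 2 * ‖y'‖ ^ 2 + 2 * (Real.sqrt (‖v‖ ^ 2 - (inner ℝ v t) ^ 2 + a) * ‖y''‖) := by
        rw [abs_mul, abs_two, abs_of_nonneg h1, abs_mul, abs_two]
        exact add_le_add (by linarith) (by linarith)
    _ = _ := by ring

/-- **`‖S″‖ ≤ 28/d³ + 6κ/d²`** for the second path-derivative of a Lorentzian strand (module docstring), `‖y′‖ ≤ 1`, `‖y″‖ ≤ κ`, `d² ≤ q`, `d > 0`,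
`a ≥ 0`, `‖t‖ = 1`. [folklore] -/
theorem norm_lorentzStrand_deriv_two_le {a d κ : ℝ} (ha : 0 ≤ a) (hd : 0 < d) (t v y' y'' : EuclideanSpace ℝ (Fin 3)) (ht : ‖t‖ = 1)
    (hy' : ‖y'‖ ≤ 1) (hy'' : ‖y''‖ ≤ κ) (hdq : d ^ 2 ≤ ‖v‖ ^ 2 - (inner ℝ v t) ^ 2 + a) :
    ‖(-(2 * (2 * ⟪y', y'⟫_ℝ + 2 * ⟪v, y''⟫_ℝ - 2 * ⟪y', t⟫_ℝ ^ 2 - 2 * ⟪v, t⟫_ℝ * ⟪y'', t⟫_ℝ)) / (‖v‖ ^ 2 - (inner ℝ v t) ^ 2 + a) ^ 2 +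
          4 * (2 * ⟪v, y'⟫_ℝ - 2 * ⟪v, t⟫_ℝ * ⟪y', t⟫_ℝ) ^ 2 / (‖v‖ ^ 2 - (inner ℝ v t) ^ 2 + a) ^ 3) • cross t v -
        (4 * (2 * ⟪v, y'⟫_ℝ - 2 * ⟪v, t⟫_ℝ * ⟪y', t⟫_ℝ) / (‖v‖ ^ 2 - (inner ℝ v t) ^ 2 + a) ^ 2) • cross t y' +
        (2 / (‖v‖ ^ 2 - (inner ℝ v t) ^ 2 + a)) • cross t y''‖ ≤ 28 / d ^ 3 + 6 * κ / d ^ 2 := by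
  have hκ0 : 0 ≤ κ := (norm_nonneg _).trans hy''
  set q := ‖v‖ ^ 2 - (inner ℝ v t) ^ 2 + a with hq
  set q1 := 2 * ⟪v, y'⟫_ℝ - 2 * ⟪v, t⟫_ℝ * ⟪y', t⟫_ℝ with hq1
  set q2 := 2 * ⟪y', y'⟫_ℝ + 2 * ⟪v, y''⟫_ℝ - 2 * ⟪y', t⟫_ℝ ^ 2 - 2 * ⟪v, t⟫_ℝ * ⟪y'', t⟫_ℝ with hq2
  have hqpos : 0 < q := lt_of_lt_of_le (by positivity) hdq
  set r := Real.sqrt q with hr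
  have hr0 : 0 < r := Real.sqrt_pos.2 hqpos
  have hrq : r ^ 2 = q := Real.sq_sqrt hqpos.le
  have hdr : d ≤ r := by rw [hr]; exact Real.le_sqrt_of_sq_le hdq
  -- scalar bounds
  have hq1b : |q1| ≤ 2 * r := by
    have h := abs_lorentzQ_deriv_le ha t v y' ht
    rw [← hq1, ← hq, ← hr] at h
    calc |q1| ≤ 2 * r * ‖y'‖ := h
      _ ≤ 2 * r * 1 := by gcongr
      _ = 2 * r := mul_one _
  have hq2b : |q2| ≤ 2 + 2 * r * κ := by
    have h := abs_lorentzQ_deriv_two_le ha t v y' y'' ht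
    rw [← hq2, ← hq, ← hr] at h
    have h1 : ‖y'‖ ^ 2 ≤ 1 := by nlinarith [norm_nonneg y']
    calc |q2| ≤ 2 * ‖y'‖ ^ 2 + 2 * r * ‖y''‖ := h
      _ ≤ 2 * 1 + 2 * r * κ := by gcongr
      _ = 2 + 2 * r * κ := by ring
  have hcv : ‖cross t v‖ ≤ r := by rw [hr, hq]; exact norm_cross_le_sqrt_lorentzQ ha t v ht
  have hcy' : ‖cross t y'‖ ≤ 1 := by
    have h := norm_cross_le_norm_mul_norm t y'; rw [ht, one_mul] at h; exact h.trans hy'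
  have hcy'' : ‖cross t y''‖ ≤ κ := by
    have h := norm_cross_le_norm_mul_norm t y''; rw [ht, one_mul] at h; exact h.trans hy''
  -- the three pieces, in powers of r
  have hq_eq : q = r ^ 2 := hrq.symm
  have p1 : ‖(-(2 * q2) / q ^ 2 + 4 * q1 ^ 2 / q ^ 3) • cross t v‖ ≤ 20 / r ^ 3 + 4 * κ / r ^ 2 := by
    rw [norm_smul, Real.norm_eq_abs]
    have hcoef : |-(2 * q2) / q ^ 2 + 4 * q1 ^ 2 / q ^ 3| ≤ (2 * (2 + 2 * r * κ)) / q ^ 2 + 4 * (2 * r) ^ 2 / q ^ 3 := by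
      refine (abs_add_le _ _).trans (add_le_add ?_ ?_)
      · rw [abs_div, abs_neg, abs_mul, abs_two, abs_of_pos (by positivity : (0:ℝ) < q ^ 2)]
        gcongr
      · rw [abs_div, abs_of_nonneg (by positivity : (0:ℝ) ≤ 4 * q1 ^ 2), abs_of_pos (by positivity : (0:ℝ) < q ^ 3)]
        gcongr (4 * ?_) / q ^ 3
        rw [← sq_abs q1]; exact pow_le_pow_left₀ (abs_nonneg _) hq1b 2
    calc |-(2 * q2) / q ^ 2 + 4 * q1 ^ 2 / q ^ 3| * ‖cross t v‖ ≤ ((2 * (2 + 2 * r * κ)) / q ^ 2 + 4 * (2 * r) ^ 2 / q ^ 3) * r :=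
          mul_le_mul hcoef hcv (norm_nonneg _) (by positivity)
      _ = 20 / r ^ 3 + 4 * κ / r ^ 2 := by rw [hq_eq]; field_simp; ring
  have p2 : ‖(4 * q1 / q ^ 2) • cross t y'‖ ≤ 8 / r ^ 3 := by
    rw [norm_smul, Real.norm_eq_abs, abs_div, abs_mul, abs_of_pos (by norm_num : (0:ℝ) < 4), abs_of_pos (by positivity : (0:ℝ) < q ^ 2)]
    calc 4 * |q1| / q ^ 2 * ‖cross t y'‖ ≤ 4 * (2 * r) / q ^ 2 * 1 := by gcongr
      _ = 8 / r ^ 3 := by rw [hq_eq]; field_simp; ring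
  have p3 : ‖(2 / q) • cross t y''‖ ≤ 2 * κ / r ^ 2 := by
    rw [norm_smul, Real.norm_eq_abs, abs_div, abs_two, abs_of_pos hqpos]
    calc 2 / q * ‖cross t y''‖ ≤ 2 / q * κ := by gcongr
      _ = 2 * κ / r ^ 2 := by rw [hq_eq]; ring
  -- assemble and pass from r to d
  have hsum : ‖(-(2 * q2) / q ^ 2 + 4 * q1 ^ 2 / q ^ 3) • cross t v - (4 * q1 / q ^ 2) • cross t y' + (2 / q) • cross t y''‖ ≤
      28 / r ^ 3 + 6 * κ / r ^ 2 := by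
    calc _ ≤ ‖(-(2 * q2) / q ^ 2 + 4 * q1 ^ 2 / q ^ 3) • cross t v - (4 * q1 / q ^ 2) • cross t y'‖ + ‖(2 / q) • cross t y''‖ := norm_add_le _ _
      _ ≤ (‖(-(2 * q2) / q ^ 2 + 4 * q1 ^ 2 / q ^ 3) • cross t v‖ + ‖(4 * q1 / q ^ 2) • cross t y'‖) + ‖(2 / q) • cross t y''‖ := by
          gcongr; exact norm_sub_le _ _
      _ ≤ (20 / r ^ 3 + 4 * κ / r ^ 2 + 8 / r ^ 3) + 2 * κ / r ^ 2 := add_le_add (add_le_add p1 p2) p3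
      _ = 28 / r ^ 3 + 6 * κ / r ^ 2 := by ring
  refine hsum.trans (add_le_add ?_ ?_)
  · exact div_le_div_of_nonneg_left (by norm_num) (by positivity) (pow_le_pow_left₀ hd.le hdr 3)
  · exact div_le_div_of_nonneg_left (by positivity) (by positivity) (pow_le_pow_left₀ hd.le hdr 2)

end Summit.NavierStokesRegularity.NavierStokesRegularity.Theorems.SkeletonJ1RFrame

end
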